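import Literature.AlgebraicGeometry.Morphisms.FormalFunctionsModule
import Literature.AlgebraicGeometry.Resolution.FiniteOverCompleteLocal
import Mathlib.RingTheory.WittVector.Complete
import Mathlib.RingTheory.WittVector.DiscreteValuationRing
import HarnessLib

/-!
# Formal functions for `H⁰` of a coherent module over an `a`-adically complete base

Sibling file of `Literature/AlgebraicGeometry/Morphisms/FormalFunctionsModule.lean`, which proves
the two halves (Artin–Rees stability and levelwise lifting, with explicit shifts) of the theorem on
formal functions for `H⁰` of a coherent module `M` on a proper scheme `f : X → Spec A` over a
noetherian ring along a PRINCIPAL ideal `I = (a)` (Görtz–Wedhorn, *Algebraic Geometry II*, Thm.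
24.37, p. 525, case `p = 0`: "`lim_n H⁰(X, 𝓕/Iⁿ𝓕) = lim_n H⁰(X, 𝓕)/IⁿH⁰(X, 𝓕)`"; The Stacks
Project, Tag 02OC; EGA III₁ 4.1.5). Here the two halves are assembled into the printed statement in
the case the base ring is `a`-ADICALLY COMPLETE — then `H⁰(X, M)`, a finite `A`-module (finiteness
of `Ȟ⁰` of coherent modules on proper `A`-schemes, Görtz–Wedhorn II Thm. 23.17, via the dévissage
`DevissageHeart.heart_holds`), is itself `a`-adically complete (Matsumura, Thm. 8.7; tree
`Resolution.isAdicComplete_of_finite`), so that the right hand side is `H⁰(X, M)`: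

* `modPow f M a k = M/a^kM := coker (a^k · 𝟙_M)`, `modPowπ` (the projection), `modPowSucc`,
  `modPowLE` (the transition maps `M/a^{k+d}M → M/a^kM` under `M`), `formalSectionsModule f M a` —
  the `A`-module `lim_k Γ(X, M/a^kM)` of compatible families —, and the canonical `A`-linear map
  `toFormalSectionsModule f M a : Γ(X, M) → lim_k Γ(X, M/a^kM)`, `s ↦ (s mod a^k)_k`;
* `toFormalSectionsModule_bijective` — **Görtz–Wedhorn II Thm. 24.37 (`p = 0`, `I = (a)`) over an
  `a`-adically complete noetherian `A`: for `f : X → Spec A` proper and `M` coherent,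
  `Γ(X, M) → lim_k Γ(X, M/a^kM)` is bijective** (injective: an element of the kernel lies in
  `⋂_n aⁿΓ(X, M) = 0`; surjective: lifts `s_k` of the levels of a compatible family form an
  `a`-adically Cauchy sequence by the Artin–Rees half, and its limit maps to the family);
* `toFormalSectionsModule_bijective_wittVector` — the instance `A = W(k)`, `a = p` for a perfect
  field `k` of characteristic `p` (Mathlib: `W(k)` is a `p`-adically complete discrete valuation
  ring), the form in which the statement enters Grothendieck's existence theorem over `W(k)`
  (Görtz–Wedhorn II Thm. 24.94, through Construction 24.104 and Lemma 24.105).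

Everything is proved; no named facts are introduced. Not here: the comparison of `Γ(X, M/a^kM)` with
`Γ(X_k, i_k^* M)` for the closed subscheme `X_k = X ×_A A/a^k` (Görtz–Wedhorn, loc. cit.:
"`𝓕/Iⁿ𝓕 = (i_n)_* i_n^* 𝓕`"), which is adjunction bookkeeping for Mathlib's
`Scheme.Modules.pullback` and is left to the consumers.

## References

* U. Görtz, T. Wedhorn, *Algebraic Geometry II: Cohomology of Schemes*, Springer Spektrum (2023),
  doi:10.1007/978-3-658-43031-3: Thm. 24.37 (p. 525), Thm. 23.17 (p. 424), Thm. 24.94 and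
  Construction 24.104, Lemma 24.105 (pp. 566–573). [GortzWedhorn2023]
* The Stacks Project, Tag 02OC (Cohomology of Schemes, Theorem 30.20.5). [StacksProject]
* H. Matsumura, *Commutative Ring Theory* (1986), Thm. 8.7. [Matsumura1987]
-/

noncomputable section

open CategoryTheory AlgebraicGeometry Limits TopologicalSpace Opposite
open Literature.AlgebraicGeometry.Modules

universe u

namespace Literature.AlgebraicGeometry.Morphisms

variable {A : Type u} [CommRing A] {X : Scheme.{u}} (f : X ⟶ Spec (.of A)) (M : X.Modules) (a : A)

/-! ## The quotients `M/a^kM` and their transition maps -/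

/-- `M/a^kM := coker (a^k · 𝟙_M)`, the cokernel in the abelian category `X.Modules` of
multiplication by (the image in `Γ(X, 𝒪_X)` of) `a^k` (Görtz–Wedhorn II, Thm. 24.37: "`𝓕/Iⁿ𝓕`",
`I = (a)`). [cite: GortzWedhorn2023, Thm. 24.37 (p. 525)] -/
abbrev modPow (k : ℕ) : X.Modules := cokernel (globalScalar M (algebraMapΓ f (a ^ k)))

/-- The projection `M → M/a^kM`. [folklore] -/
abbrev modPowπ (k : ℕ) : M ⟶ modPow f M a k := cokernel.π _

/-- `a^{k+d} · 𝟙_M` dies in `M/a^kM`. [folklore] -/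
theorem globalScalar_pow_add_comp_modPowπ (k d : ℕ) :
    globalScalar M (algebraMapΓ f (a ^ (k + d))) ≫ modPowπ f M a k = 0 := by
  rw [pow_add, map_mul, globalScalar_mul, Category.assoc]
  change _ ≫ globalScalar M (algebraMapΓ f (a ^ k)) ≫
    cokernel.π (globalScalar M (algebraMapΓ f (a ^ k))) = 0
  rw [cokernel.condition, comp_zero]

/-- The transition map `M/a^{k+1}M → M/a^kM` (the unique morphism under `M`). [folklore] -/
def modPowSucc (k : ℕ) : modPow f M a (k + 1) ⟶ modPow f M a k :=
  cokernel.desc _ (modPowπ f M a k) (globalScalar_pow_add_comp_modPowπ f M a k 1)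

/-- `M → M/a^{k+1}M → M/a^kM` is `M → M/a^kM`. [folklore] -/
@[reassoc]
theorem modPowπ_modPowSucc (k : ℕ) : modPowπ f M a (k + 1) ≫ modPowSucc f M a k = modPowπ f M a k :=
  cokernel.π_desc _ _ _

/-- The transition map `M/a^{k+d}M → M/a^kM`, the composite of the one-step transitions.
[folklore] -/
def modPowLE (k : ℕ) : ∀ d : ℕ, modPow f M a (k + d) ⟶ modPow f M a k
  | 0 => 𝟙 _
  | d + 1 => modPowSucc f M a (k + d) ≫ modPowLE k d

/-- `M → M/a^{k+d}M → M/a^kM` is `M → M/a^kM`. [folklore] -/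
@[reassoc]
theorem modPowπ_modPowLE (k : ℕ) : ∀ d : ℕ, modPowπ f M a (k + d) ≫ modPowLE f M a k d = modPowπ f M a k
  | 0 => Category.comp_id _
  | d + 1 => by
    change modPowπ f M a (k + d + 1) ≫ modPowSucc f M a (k + d) ≫ modPowLE f M a k d = _
    rw [modPowπ_modPowSucc_assoc, modPowπ_modPowLE k d]

/-- A family of sections compatible under the one-step transitions is compatible under all
transitions. [folklore] -/
theorem app_modPowLE_of_compatible {V : X.Opens} {t : ∀ k, MSections f (modPow f M a k) V}
    (ht : ∀ k, MSections.app f (modPowSucc f M a k) V (t (k + 1)) = t k) (k : ℕ) :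
    ∀ d : ℕ, MSections.app f (modPowLE f M a k d) V (t (k + d)) = t k
  | 0 => rfl
  | d + 1 => by
    change MSections.app f (modPowSucc f M a (k + d) ≫ modPowLE f M a k d) V (t (k + d + 1)) = t k
    rw [MSections.app_comp, ht, app_modPowLE_of_compatible ht k d]

/-- `a^k` kills the sections of `M/a^kM`: `(a^k • s) mod a^k = 0` for `s ∈ Γ(V, M)`. [folklore] -/
theorem app_modPowπ_pow_smul (k : ℕ) (V : X.Opens) (s : MSections f M V) :
    MSections.app f (modPowπ f M a k) V (a ^ k • s) = 0 := by
  rw [← app_globalScalar_algebraMapΓ f M (a ^ k) V s, ← MSections.app_comp]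
  change MSections.app f (globalScalar M (algebraMapΓ f (a ^ k)) ≫
    cokernel.π (globalScalar M (algebraMapΓ f (a ^ k)))) V s = 0
  rw [cokernel.condition, MSections.app_zero]

/-! ## `lim_k Γ(X, M/a^kM)` and the canonical map from `Γ(X, M)` -/

/-- **`lim_k Γ(X, M/a^kM)`**: the `A`-module of families `(t_k ∈ Γ(X, M/a^kM))_k` compatible under
the transition maps `M/a^{k+1}M → M/a^kM` (the left hand side of Görtz–Wedhorn II (24.6.4) for
`p = 0`, `I = (a)`, as a submodule of the product). [cite: GortzWedhorn2023, Thm. 24.37 (p. 525)] -/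
def formalSectionsModule : Submodule A (∀ k, MSections f (modPow f M a k) ⊤) where
  carrier := {t | ∀ k, MSections.app f (modPowSucc f M a k) ⊤ (t (k + 1)) = t k}
  add_mem' {t t'} ht ht' k := by
    change MSections.app f (modPowSucc f M a k) ⊤ (t (k + 1) + t' (k + 1)) = t k + t' k
    rw [map_add, ht k, ht' k]
  zero_mem' k := by
    change MSections.app f (modPowSucc f M a k) ⊤ 0 = 0
    rw [map_zero]
  smul_mem' c t ht k := by
    change MSections.app f (modPowSucc f M a k) ⊤ (c • t (k + 1)) = c • t k
    rw [map_smul, ht k]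

/-- Membership in `formalSectionsModule`: compatibility under the one-step transitions. [folklore] -/
theorem mem_formalSectionsModule_iff (t : ∀ k, MSections f (modPow f M a k) ⊤) :
    t ∈ formalSectionsModule f M a ↔
      ∀ k, MSections.app f (modPowSucc f M a k) ⊤ (t (k + 1)) = t k :=
  Iff.rfl

/-- **The canonical map `Γ(X, M) → lim_k Γ(X, M/a^kM)`**, `s ↦ (s mod a^k)_k` (the map of
Görtz–Wedhorn II (24.6.4), `p = 0`, before completing the source). [cite: GortzWedhorn2023, Thm. 24.37 (p. 525)] -/
def toFormalSectionsModule : MSections f M ⊤ →ₗ[A] formalSectionsModule f M a :=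
  LinearMap.codRestrict _ (LinearMap.pi fun k => MSections.app f (modPowπ f M a k) ⊤) fun s k => by
    change MSections.app f (modPowSucc f M a k) ⊤ (MSections.app f (modPowπ f M a (k + 1)) ⊤ s) =
      MSections.app f (modPowπ f M a k) ⊤ s
    rw [← MSections.app_comp, modPowπ_modPowSucc]

/-- Components of `toFormalSectionsModule`. [folklore] -/
@[simp]
theorem toFormalSectionsModule_apply (s : MSections f M ⊤) (k : ℕ) :
    (toFormalSectionsModule f M a s : ∀ k, MSections f (modPow f M a k) ⊤) k =
      MSections.app f (modPowπ f M a k) ⊤ s :=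
  rfl

/-! ## Finiteness and completeness of `Γ(X, M)` -/

variable {M}

/-- **`Γ(X, M)` is a finite `A`-module** for `M` coherent on a proper `A`-scheme over a noetherian
ring (Görtz–Wedhorn II Thm. 23.17 / Cor. 23.18 for `i = 0`: `Ȟ⁰ = Γ`, and the dévissage
`Morphisms/Devissage` with integral step `DevissageHeart.heart_holds`).
[cite: GortzWedhorn2023, Thm. 23.17 (p. 424)] -/
theorem moduleFinite_msections_of_coh [IsNoetherianRing A] [IsProper f] (hM : Coh M) :
    Module.Finite A (MSections f M ⊤) := by
  haveI : IsLocallyNoetherian X := LocallyOfFiniteType.isLocallyNoetherian f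
  haveI : CompactSpace X := QuasiCompact.compactSpace_of_compactSpace f
  obtain ⟨T, hT⟩ := exists_finite_affineOpens_iSup_eq_top (X := X)
  have hK : InK f (fun V : T => ((V : X.affineOpens) : X.Opens)) M :=
    devissage (f := f) (U := fun V : T => ((V : X.affineOpens) : X.Opens)) (fun V => V.1.2)
      (heart_holds f (fun V => V.1.2) hT) M hM
  haveI := hK.finite_H0
  exact (moduleFinite_cechMH0_iff f _ M hT).mp hK.finite_H0

/-- Hence `Γ(X, M)` is `a`-adically complete when `A` is (Matsumura, Thm. 8.7).
[cite: Matsumura1987, Thm. 8.7] -/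
theorem isAdicComplete_msections_of_coh [IsNoetherianRing A] [IsProper f]
    [IsAdicComplete (Ideal.span {a}) A] (hM : Coh M) :
    IsAdicComplete (Ideal.span {a}) (MSections f M ⊤) :=
  haveI := moduleFinite_msections_of_coh f hM
  Resolution.isAdicComplete_of_finite _ _

/-- `aⁿ • u ∈ (a)ⁿ Γ`. [folklore] -/
theorem pow_smul_mem_pow_smul_top {N : Type*} [AddCommGroup N] [Module A N] (n : ℕ) (u : N) :
    a ^ n • u ∈ (Ideal.span {a} ^ n • ⊤ : Submodule A N) := by
  rw [Ideal.span_singleton_pow]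
  exact Submodule.smul_mem_smul (Ideal.mem_span_singleton_self _) Submodule.mem_top

/-- Elements of `(a)ⁿ Γ` are `aⁿ`-multiples. [folklore] -/
theorem exists_eq_pow_smul_of_mem_pow_smul_top {N : Type*} [AddCommGroup N] [Module A N] (n : ℕ)
    {x : N} (hx : x ∈ (Ideal.span {a} ^ n • ⊤ : Submodule A N)) : ∃ u : N, x = a ^ n • u := by
  rw [Ideal.span_singleton_pow, Submodule.ideal_span_singleton_smul,
    Submodule.mem_smul_pointwise_iff_exists] at hx
  obtain ⟨u, -, rfl⟩ := hx
  exact ⟨u, rfl⟩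

/-! ## The theorem on formal functions over a complete base -/

/-- **Injectivity of `Γ(X, M) → lim_k Γ(X, M/a^kM)`** over an `a`-adically complete noetherian
`A`, for `f` proper and `M` coherent: a section dying at all levels lies in `aⁿΓ(X, M)` for all `n`
(Artin–Rees half `exists_eq_pow_smul_of_app_cokernel_π_eq_zero`), hence is `0`, the finite
`A`-module `Γ(X, M)` being `a`-adically separated. [cite: GortzWedhorn2023, Thm. 24.37 (p. 525)] -/
theorem toFormalSectionsModule_injective [IsNoetherianRing A] [IsProper f]
    [IsAdicComplete (Ideal.span {a}) A] (hM : Coh M) :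
    Function.Injective (toFormalSectionsModule f M a) := by
  haveI := isAdicComplete_msections_of_coh f a hM
  rw [injective_iff_map_eq_zero]
  intro s hs
  obtain ⟨c, hc⟩ := exists_eq_pow_smul_of_app_cokernel_π_eq_zero f a hM
  refine IsHausdorff.haus (IsAdicComplete.toIsHausdorff (I := Ideal.span {a})
    (M := MSections f M ⊤)) s fun n => ?_
  obtain ⟨u, hu⟩ := hc n s (by
    have h := congrArg (fun t : formalSectionsModule f M a =>
      (t : ∀ k, MSections f (modPow f M a k) ⊤) (n + c)) hs
    exact h)
  rw [SModEq.zero, hu]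
  exact pow_smul_mem_pow_smul_top a n u

/-- **Surjectivity of `Γ(X, M) → lim_k Γ(X, M/a^kM)`** over an `a`-adically complete noetherian
`A`, for `f` proper and `M` coherent: choose lifts `s_k ∈ Γ(X, M)` of the levels `t_k` of a
compatible family (possible from level `k + c` on, levelwise-lifting half
`exists_app_cokernel_π_eq_of_le`); consecutive lifts agree modulo `a^k` at level `k`, so differ by
an element of `a^{k-c'}Γ(X, M)` (Artin–Rees half); the sequence is `a`-adically Cauchy in the
complete module `Γ(X, M)` and its limit maps to `(t_k)_k`.
[cite: GortzWedhorn2023, Thm. 24.37 (p. 525) and its direct proof (p. 528)] -/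
theorem toFormalSectionsModule_surjective [IsNoetherianRing A] [IsProper f]
    [IsAdicComplete (Ideal.span {a}) A] (hM : Coh M) :
    Function.Surjective (toFormalSectionsModule f M a) := by
  haveI hcpl := isAdicComplete_msections_of_coh f a hM
  obtain ⟨c, hc⟩ := exists_app_cokernel_π_eq_of_le f a hM
  obtain ⟨c', hc'⟩ := exists_eq_pow_smul_of_app_cokernel_π_eq_zero f a hM
  intro t
  have ht : ∀ k, MSections.app f (modPowSucc f M a k) ⊤
      ((t : ∀ k, MSections f (modPow f M a k) ⊤) (k + 1)) =
        (t : ∀ k, MSections f (modPow f M a k) ⊤) k := t.2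
  -- lifts `s k` of the level `t k`, through level `k + c`
  have hlift : ∀ k, ∃ s : MSections f M ⊤,
      MSections.app f (modPowπ f M a k) ⊤ s = (t : ∀ k, MSections f (modPow f M a k) ⊤) k := by
    intro k
    obtain ⟨s, hs⟩ := hc k (k + c) le_rfl (modPowLE f M a k c) (modPowπ_modPowLE f M a k c)
      ((t : ∀ k, MSections f (modPow f M a k) ⊤) (k + c))
    exact ⟨s, hs.trans (app_modPowLE_of_compatible f M a ht k c)⟩
  choose s hs using hlift
  -- consecutive lifts differ by `a^k`-multiples from index `c'` on
  have hdiff : ∀ k, ∃ u : MSections f M ⊤, s (k + c' + 1) - s (k + c') = a ^ k • u := by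
    intro k
    refine hc' k _ ?_
    change MSections.app f (modPowπ f M a (k + c')) ⊤ (s (k + c' + 1) - s (k + c')) = 0
    rw [map_sub, sub_eq_zero, hs, ← modPowπ_modPowSucc f M a (k + c'), MSections.app_comp, hs, ht]
  -- so `k ↦ s (k + c')` is `a`-adically Cauchy
  have hcauchy : ∀ {m n : ℕ}, m ≤ n →
      s (m + c') ≡ s (n + c') [SMOD (Ideal.span {a} ^ m • ⊤ : Submodule A (MSections f M ⊤))] := by
    intro m n hmn
    rw [SModEq.sub_mem]
    induction n, hmn using Nat.le_induction with
    | base => rw [sub_self]; exact Submodule.zero_mem _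
    | succ n hmn ih =>
      obtain ⟨u, hu⟩ := hdiff n
      have e : s (m + c') - s (n + 1 + c') =
          (s (m + c') - s (n + c')) - (s (n + c' + 1) - s (n + c')) := by
        rw [show n + 1 + c' = n + c' + 1 by ring]; abel
      rw [e, hu]
      exact Submodule.sub_mem _ ih (Submodule.smul_mono_left (Ideal.pow_le_pow_right hmn)
        (pow_smul_mem_pow_smul_top a n u))
  obtain ⟨L, hL⟩ := IsPrecomplete.prec (IsAdicComplete.toIsPrecomplete (I := Ideal.span {a})
    (M := MSections f M ⊤)) hcauchy
  refine ⟨L, Subtype.ext (funext fun k => ?_)⟩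
  rw [toFormalSectionsModule_apply]
  -- `L = s (k + c') - a^k u`, and `s (k + c') mod a^k = t k`
  obtain ⟨u, hu⟩ := exists_eq_pow_smul_of_mem_pow_smul_top a k (SModEq.sub_mem.mp (hL k))
  rw [show L = s (k + c') - a ^ k • u by rw [← hu, sub_sub_cancel], map_sub, app_modPowπ_pow_smul,
    sub_zero, ← modPowπ_modPowLE f M a k c', MSections.app_comp, hs,
    app_modPowLE_of_compatible f M a ht k c']

/-- **Theorem on formal functions for `H⁰`, principal ideal, complete base (Görtz–Wedhorn II
Thm. 24.37, `p = 0`, `I = (a)`; The Stacks Project, Tag 02OC).** Let `A` be a noetherian ring which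
is `a`-adically complete, `f : X → Spec A` proper and `M` a coherent `𝒪_X`-module. Then the canonical
map `Γ(X, M) → lim_k Γ(X, M/a^kM)` is bijective. (Printed: "`lim_n H⁰(X, 𝓕/Iⁿ𝓕) =
lim_n H⁰(X, 𝓕)/IⁿH⁰(X, 𝓕)`", and the right hand side is `H⁰(X, 𝓕)` itself because this finite
`A`-module is `I`-adically complete, Matsumura Thm. 8.7.)
[cite: GortzWedhorn2023, Thm. 24.37 (p. 525)] -/
theorem toFormalSectionsModule_bijective [IsNoetherianRing A] [IsProper f]
    [IsAdicComplete (Ideal.span {a}) A] (hM : Coh M) :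
    Function.Bijective (toFormalSectionsModule f M a) :=
  ⟨toFormalSectionsModule_injective f a hM, toFormalSectionsModule_surjective f a hM⟩

/-- **The `W(k)`-instance** (the base of Grothendieck's existence theorem over the Witt vectors,
Görtz–Wedhorn II Thm. 24.94 with Construction 24.104 / Lemma 24.105): for `k` a perfect field of
characteristic `p`, `X → Spec W(k)` proper and `M` a coherent `𝒪_X`-module,
`Γ(X, M) → lim_n Γ(X, M/pⁿM)` is bijective (`W(k)` is a noetherian `p`-adically complete ring:
Mathlib `WittVector.isDiscreteValuationRing`, `WittVector.isAdicCompleteIdealSpanP`).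
[cite: GortzWedhorn2023, Thm. 24.37 (p. 525) and Thm. 24.94 (p. 566)] -/
theorem toFormalSectionsModule_bijective_wittVector {p : ℕ} [Fact p.Prime] {k : Type u} [Field k]
    [CharP k p] [PerfectRing k p] {X : Scheme.{u}} (f : X ⟶ Spec (.of (WittVector p k)))
    [IsProper f] {M : X.Modules} (hM : Coh M) :
    Function.Bijective (toFormalSectionsModule f M (p : WittVector p k)) :=
  toFormalSectionsModule_bijective f (p : WittVector p k) hM

end Literature.AlgebraicGeometry.Morphisms

end
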